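import Mathlib
import Summits.NavierStokesRegularity.NavierStokesRegularity.Theorems.PoloidalWindowDoorPoloidalWindowRigidityZShockTurningShear

/-!
# Crux K2 `PoloidalWindowRigidity` (stmt-NavierStokesRegularity-19708), line `z_shock` — R3 inhabitant census: QUADRATIC SLICES of the
# THICK autonomous height-evolution with an affine structure function are turning shears (the quadratic part blows up at finite height),
# and the SIGN (hyperbolicity) clause of the turning-shear rung is load-bearing

`--supports stmt-NavierStokesRegularity-19708 --as helper` (leafhand-ns-poloidalwindowdoor-3 g19, cell decomp-ns, 2026-09-01).  Class-free,
def-free; Mathlib + part I (`…ZShockTurningShear`, p839511).  **No stub and no summit is closed by this file; Navier–Stokes regularity is NOT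
proved here (rung 0).**

Part I settled the affine slices `W = A(s) + β(s)·y` of the autonomous height-evolution `∂ₛ∂ₛW = γ(W)ΔW + γ'(W)|∇W|²`
(`…ZShockSliceTyping.slice_wave_pde`; `γ' ≢ 0` = THICK): genuine nonlinearity alone empties the family.  This part records the next
polynomial degree and a tightness fact (evidence #44 INHABITANT-SEARCH-g19.md on the crux item, families A1/A2):

  QUADRATIC SLICES `W(s,y) = A(s) + B(s)y₀ + C(s)y₁ + ½(D(s)y₀² + 2E(s)y₀y₁ + G(s)y₁²)` with an AFFINE structure function
  `γ(t) = γ₀ + 2μt` (`γ' ≡ 2μ`, THICK iff `μ ≠ 0`; the case left over by degree counting — for a polynomial `γ` of degree `k ≥ 2` the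
  top-order terms in `y` already force `½(tr Q)Q + kQ² = 0`, i.e. `Q = 0`; elementary, not formalised here).  Then `ΔW = D + G =: T`, `|∇W|² = (B + Dy₀ + Ey₁)² + (C + Ey₀ + Gy₁)²`, and the height-evolution is the polynomial
  identity `hpde` below; its `y₀², y₀y₁, y₁²` coefficients give `D'' = 2μDT + 4μ(D² + E²)`, `E'' = 6μET`, `G'' = 2μGT + 4μ(E² + G²)`, hence
  for the trace `T'' = 2μT² + 4μ(D² + 2E² + G²)` — superquadratic of one sign, with NO sign hypothesis on `γ`.

* `deriv_eq_zero_of_convex_nonpos` — a `C²` function with `I'' ≥ 0` and `I ≤ 0` on `ℝ` has `I' ≡ 0` (a convex function bounded above is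
  constant); `superquadratic_eq_zero` — with part I's `superquadratic_nonpos`: `I'' ≥ 2b I²`, `b > 0`, on `ℝ` ⇒ `I ≡ 0` and `I'' ≡ 0`.
* ★ `quadSlice_flat_of_affine_thick` — **quadratic slices with `γ' ≡ 2μ ≠ 0` have `D ≡ E ≡ G ≡ 0`** (they are turning shears; then part I's
  `affineSlice_not_thick` applies as soon as hyperbolicity `γ ≥ 0` holds on the value range `ℝ`, forcing `μ = 0`).  No boundedness and no
  sign hypothesis: the quadratic part breaks down at finite height in BOTH the hyperbolic and the elliptic regime.
* `affineSlice_mixedType_inhabited` — TIGHTNESS of part I's rung: WITHOUT the sign clause `γ ≥ 0` the affine family IS inhabited by an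
  entire, twisted, everywhere-THICK member: `γ(t) = 2μt` (`μ ≠ 0`), `W = μ(s² + s⁴/6) + y₀ + s·y₁` (`A'' = 2μ(1 + s²) = γ'·|β|²`,
  `β ∧ β' = 1`) — a mixed-type (sign-changing `γ`) pattern; so in `affineSlice_not_thick` hyperbolicity on the whole value range is
  load-bearing, exactly as the THICK clause is (part I's `affineSlice_TH_inhabited`).

Honest scope: toy sub-families of R3 (`hGN` stays XL, not in print); kinematic (no NS); the substitution of the ansatz is the displayed
coefficient identity, taken as hypothesis.  presearch: as part I (textbook ODE blow-up; nothing in the crux records). [folklore]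
-/

noncomputable section

namespace Summit.NavierStokesRegularity.NavierStokesRegularity.Theorems.PoloidalWindowDoorPoloidalWindowRigidityZShockTurningShearQuadratic

-- the summit and its single sub-problem share the name (CONVENTIONS §1)
set_option linter.dupNamespace false

open Set Filter Topology
open Summit.NavierStokesRegularity.NavierStokesRegularity.Theorems.PoloidalWindowDoorPoloidalWindowRigidityZShockTurningShear

/-! ## ODE kernel, two-sided form -/

/-- **A convex function bounded above is constant**, in derivative form: `I ∈ C²(ℝ)` with `I'' ≥ 0` and `I ≤ 0` everywhere has `I' ≡ 0`
(a non-zero slope at one point makes `I` exceed `0` far to the right or far to the left, by the mean value inequality). [folklore] -/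
theorem deriv_eq_zero_of_convex_nonpos {I I' I'' : ℝ → ℝ}
    (hI : ∀ z, HasDerivAt I (I' z) z) (hI' : ∀ z, HasDerivAt I' (I'' z) z)
    (hI''nn : ∀ z, 0 ≤ I'' z) (hle : ∀ z, I z ≤ 0) : ∀ z, I' z = 0 := by
  have hIdiff : Differentiable ℝ I := fun z => (hI z).differentiableAt
  have hI'diff : Differentiable ℝ I' := fun z => (hI' z).differentiableAt
  have hIderiv : ∀ z, deriv I z = I' z := fun z => (hI z).deriv
  have hI'mono : Monotone I' :=
    monotone_of_deriv_nonneg hI'diff (fun z => by rw [(hI' z).deriv]; exact hI''nn z)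
  intro z₀
  by_contra hne
  rcases lt_or_gt_of_ne hne with hneg | hpos
  · -- negative slope: `I` exceeds `0` far to the left
    have hlin : ∀ z, z ≤ z₀ → I z₀ - I z ≤ I' z₀ * (z₀ - z) := by
      intro z hz
      refine (convex_Iic z₀).image_sub_le_mul_sub_of_deriv_le hIdiff.continuous.continuousOn
        hIdiff.differentiableOn ?_ z hz z₀ self_mem_Iic hz
      intro x hx
      rw [interior_Iic] at hx
      rw [hIderiv]
      exact hI'mono (le_of_lt hx)
    have h1 := hlin (z₀ - (1 - I z₀) / (-I' z₀)) (by
      have : 0 ≤ (1 - I z₀) / (-I' z₀) := div_nonneg (by linarith [hle z₀]) (by linarith)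
      linarith)
    have h2 : I' z₀ * (z₀ - (z₀ - (1 - I z₀) / (-I' z₀))) = -(1 - I z₀) := by
      calc I' z₀ * (z₀ - (z₀ - (1 - I z₀) / (-I' z₀))) = -(1 - I z₀) * (-I' z₀ / -I' z₀) := by ring
        _ = -(1 - I z₀) := by rw [div_self (by linarith : -I' z₀ ≠ 0), mul_one]
    have h3 := hle (z₀ - (1 - I z₀) / (-I' z₀))
    linarith
  · -- positive slope: `I` exceeds `0` far to the right
    have hlin : ∀ z, z₀ ≤ z → I' z₀ * (z - z₀) ≤ I z - I z₀ := by
      intro z hz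
      refine (convex_Ici z₀).mul_sub_le_image_sub_of_le_deriv hIdiff.continuous.continuousOn
        hIdiff.differentiableOn ?_ z₀ self_mem_Ici z hz hz
      intro x hx
      rw [interior_Ici] at hx
      rw [hIderiv]
      exact hI'mono (le_of_lt hx)
    have h1 := hlin (z₀ + (1 - I z₀) / I' z₀) (by
      have : 0 ≤ (1 - I z₀) / I' z₀ := div_nonneg (by linarith [hle z₀]) hpos.le
      linarith)
    have h2 : I' z₀ * (z₀ + (1 - I z₀) / I' z₀ - z₀) = 1 - I z₀ := by
      calc I' z₀ * (z₀ + (1 - I z₀) / I' z₀ - z₀) = (1 - I z₀) * (I' z₀ / I' z₀) := by ring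
        _ = 1 - I z₀ := by rw [div_self hpos.ne', mul_one]
    have h3 := hle (z₀ + (1 - I z₀) / I' z₀)
    linarith

/-- **Two-sided superquadratic Liouville.**  `I ∈ C²(ℝ)` with `2b·I² ≤ I''` on all of `ℝ` (`b > 0`) vanishes identically, together with
`I''`: part I's `superquadratic_nonpos` gives `I ≤ 0`, convexity then gives `I' ≡ 0`, so `I'' ≡ 0 ≥ 2bI²`. [folklore] -/
theorem superquadratic_eq_zero {I I' I'' : ℝ → ℝ} {b : ℝ} (hb : 0 < b)
    (hI : ∀ z, HasDerivAt I (I' z) z) (hI' : ∀ z, HasDerivAt I' (I'' z) z)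
    (hineq : ∀ z, 2 * b * I z ^ 2 ≤ I'' z) : ∀ z, I z = 0 ∧ I'' z = 0 := by
  have hle : ∀ z, I z ≤ 0 := superquadratic_nonpos hb hI hI' hineq
  have hI''nn : ∀ z, 0 ≤ I'' z := fun z => le_trans (by positivity) (hineq z)
  have hI'0 : ∀ z, I' z = 0 := deriv_eq_zero_of_convex_nonpos hI hI' hI''nn hle
  have hI''0 : ∀ z, I'' z = 0 := by
    intro z
    have h1 : HasDerivAt I' 0 z := by
      have h2 : I' = fun _ => 0 := funext hI'0
      rw [h2]
      exact hasDerivAt_const z 0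
    exact (hI' z).unique h1
  intro z
  refine ⟨?_, hI''0 z⟩
  have h1 : 2 * b * I z ^ 2 ≤ 0 := (hineq z).trans (hI''0 z).le
  have h2 : I z ^ 2 ≤ 0 := le_of_mul_le_mul_left (by linarith : 2 * b * I z ^ 2 ≤ 2 * b * 0) (by positivity)
  exact (pow_eq_zero_iff two_ne_zero).mp (le_antisymm h2 (sq_nonneg _))

/-! ## Quadratic slices with an affine THICK structure function -/

/-- ★ **Quadratic slices of the THICK autonomous height-evolution with an affine structure function are affine.**  Let `D, G ∈ C²(ℝ)`
(derivatives given pointwise), `A, B, C, E, A'', B'', C'', E''` any real functions (only the trace `D + G` is differentiated), `γ₀ : ℝ`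
and `μ ≠ 0`.  Suppose the quadratic slice
`W(s,y) = A + By₀ + Cy₁ + ½(Dy₀² + 2Ey₀y₁ + Gy₁²)` satisfies `∂ₛ∂ₛW = γ(W)ΔW + γ'(W)|∇W|²` with `γ(t) = γ₀ + 2μt` at every height, i.e. the
polynomial identity `hpde` below for all `s, y₀, y₁`.  Then `D ≡ E ≡ G ≡ 0`: the trace `T = D + G` obeys `T'' = 2μT² + 4μ(D² + 2E² + G²)`
and `superquadratic_eq_zero` (applied to `T` or `−T` according to the sign of `μ`) kills the quadratic part — no boundedness, no sign
hypothesis on `γ`. [folklore] -/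
theorem quadSlice_flat_of_affine_thick {A B C D E G A'' B'' C'' D' G' D'' E'' G'' : ℝ → ℝ} {γ₀ μ : ℝ} (hμ : μ ≠ 0)
    (hD : ∀ z, HasDerivAt D (D' z) z) (hD' : ∀ z, HasDerivAt D' (D'' z) z)
    (hG : ∀ z, HasDerivAt G (G' z) z) (hG' : ∀ z, HasDerivAt G' (G'' z) z)
    (hpde : ∀ z y₀ y₁ : ℝ,
      A'' z + B'' z * y₀ + C'' z * y₁ + (D'' z * y₀ ^ 2 + 2 * E'' z * y₀ * y₁ + G'' z * y₁ ^ 2) / 2 =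
        (γ₀ + 2 * μ * (A z + B z * y₀ + C z * y₁ + (D z * y₀ ^ 2 + 2 * E z * y₀ * y₁ + G z * y₁ ^ 2) / 2)) * (D z + G z) +
          2 * μ * ((B z + D z * y₀ + E z * y₁) ^ 2 + (C z + E z * y₀ + G z * y₁) ^ 2)) :
    ∀ z, D z = 0 ∧ E z = 0 ∧ G z = 0 := by
  -- the three second-order coefficient identities (second differences of `hpde` in `y`)
  have hDD : ∀ z, D'' z = 2 * μ * D z * (D z + G z) + 4 * μ * (D z ^ 2 + E z ^ 2) := by
    intro z
    have h0 := hpde z 0 0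
    have h1 := hpde z 1 0
    have h2 := hpde z (-1) 0
    linear_combination h1 + h2 - 2 * h0
  have hGG : ∀ z, G'' z = 2 * μ * G z * (D z + G z) + 4 * μ * (E z ^ 2 + G z ^ 2) := by
    intro z
    have h0 := hpde z 0 0
    have h1 := hpde z 0 1
    have h2 := hpde z 0 (-1)
    linear_combination h1 + h2 - 2 * h0
  have hEE : ∀ z, E'' z = 6 * μ * E z * (D z + G z) := by
    intro z
    have h0 := hpde z 0 0
    have h1 := hpde z 1 0
    have h2 := hpde z 0 1
    have h3 := hpde z 1 1
    linear_combination h3 - h1 - h2 + h0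
  -- the trace `T = D + G`
  have hT : ∀ z, HasDerivAt (fun y => D y + G y) (D' z + G' z) z := fun z => (hD z).fun_add (hG z)
  have hT' : ∀ z, HasDerivAt (fun y => D' y + G' y) (D'' z + G'' z) z := fun z => (hD' z).fun_add (hG' z)
  have hTT : ∀ z, D'' z + G'' z = 2 * μ * (D z + G z) ^ 2 + 4 * μ * (D z ^ 2 + 2 * E z ^ 2 + G z ^ 2) := by
    intro z; rw [hDD z, hGG z]; ring
  -- conclude from the vanishing of `T` and `T''`
  have key : ∀ z, D z + G z = 0 ∧ D'' z + G'' z = 0 := by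
    rcases lt_or_gt_of_ne hμ with hneg | hpos
    · -- `μ < 0`: apply the kernel to `−T`
      have hnT : ∀ z, HasDerivAt (fun y => -(D y + G y)) (-(D' z + G' z)) z := fun z => (hT z).fun_neg
      have hnT' : ∀ z, HasDerivAt (fun y => -(D' y + G' y)) (-(D'' z + G'' z)) z := fun z => (hT' z).fun_neg
      have hineq : ∀ z, 2 * (-μ) * (-(D z + G z)) ^ 2 ≤ -(D'' z + G'' z) := by
        intro z; rw [hTT z]
        nlinarith [sq_nonneg (D z), sq_nonneg (E z), sq_nonneg (G z), sq_nonneg (D z + G z)]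
      intro z
      have h := superquadratic_eq_zero (by linarith : 0 < -μ) hnT hnT' hineq z
      constructor <;> linarith [h.1, h.2]
    · have hineq : ∀ z, 2 * μ * (D z + G z) ^ 2 ≤ D'' z + G'' z := by
        intro z; rw [hTT z]
        nlinarith [sq_nonneg (D z), sq_nonneg (E z), sq_nonneg (G z)]
      intro z
      exact superquadratic_eq_zero hpos hT hT' hineq z
  intro z
  obtain ⟨hT0, hT''0⟩ := key z
  have hsq : D z ^ 2 + 2 * E z ^ 2 + G z ^ 2 = 0 := by
    have h1 := hTT z
    rw [hT''0, hT0] at h1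
    -- `0 = 0 + 4μ·(sum of squares)` with `μ ≠ 0`
    have h2 : 4 * μ * (D z ^ 2 + 2 * E z ^ 2 + G z ^ 2) = 0 := by linarith
    rcases mul_eq_zero.mp h2 with h | h
    · exfalso; exact hμ (by linarith)
    · exact h
  have hD0 : D z = 0 := by nlinarith [sq_nonneg (D z), sq_nonneg (E z), sq_nonneg (G z)]
  have hG0 : G z = 0 := by nlinarith [sq_nonneg (D z), sq_nonneg (E z), sq_nonneg (G z)]
  have hE0 : E z = 0 := by nlinarith [sq_nonneg (D z), sq_nonneg (E z), sq_nonneg (G z)]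
  exact ⟨hD0, hE0, hG0⟩

/-! ## Tightness of part I: the sign clause is load-bearing -/

/-- **Without hyperbolicity on the whole value range the turning-shear family is inhabited by a THICK twisted member.**  For any `μ ≠ 0`
the sign-changing affine structure function `γ(t) = 2μt` (`γ' ≡ 2μ ≠ 0`: genuinely nonlinear everywhere; elliptic where `γ < 0`) admits
the entire turning shear `W(s,y) = μ(s² + s⁴/6) + y₀ + s·y₁`: the affine-slice identity of part I holds at every height
(`A'' = 2μ(1 + s²) = γ'(W)·|β|²`) and the pattern is twisted (`B C' − C B' = 1`).  So `affineSlice_not_thick` fails if its clause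
`∀ t, 0 ≤ γ t` is dropped: like genuine nonlinearity, hyperbolicity is load-bearing in the turning-shear rung. [folklore] -/
theorem affineSlice_mixedType_inhabited {μ : ℝ} (hμ : μ ≠ 0) :
    ∃ A B C B' C' A'' B'' C'' γ γ' : ℝ → ℝ,
      (∀ z, HasDerivAt B (B' z) z) ∧ (∀ z, HasDerivAt B' (B'' z) z) ∧
      (∀ z, HasDerivAt C (C' z) z) ∧ (∀ z, HasDerivAt C' (C'' z) z) ∧
      (∀ z, HasDerivAt A (2 * μ * (z + z ^ 3 / 3)) z) ∧ (∀ z, HasDerivAt (fun y : ℝ => 2 * μ * (y + y ^ 3 / 3)) (A'' z) z) ∧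
      (∀ t, HasDerivAt γ (γ' t) t) ∧ (∀ t, γ' t ≠ 0) ∧
      (∀ z x₀ x₁ : ℝ, A'' z + B'' z * x₀ + C'' z * x₁ = γ' (A z + B z * x₀ + C z * x₁) * (B z ^ 2 + C z ^ 2)) ∧
      (∀ z, B z * C' z - C z * B' z ≠ 0) ∧ (∃ z₀, B z₀ ≠ 0 ∨ C z₀ ≠ 0) := by
  refine ⟨fun z => μ * (z ^ 2 + z ^ 4 / 6), fun _ => 1, fun z => z, fun _ => 0, fun _ => 1,
    fun z => 2 * μ * (1 + z ^ 2), fun _ => 0, fun _ => 0, fun t => 2 * μ * t, fun _ => 2 * μ,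
    ?_, ?_, ?_, ?_, ?_, ?_, ?_, ?_, ?_, ?_, ⟨0, Or.inl one_ne_zero⟩⟩
  · intro z; exact hasDerivAt_const z 1
  · intro z; exact hasDerivAt_const z 0
  · intro z; exact hasDerivAt_id' z
  · intro z; exact hasDerivAt_const z 1
  · intro z
    have h := (((hasDerivAt_id' z).pow 2).fun_add (((hasDerivAt_id' z).pow 4).div_const 6)).const_mul μ
    exact h.congr_deriv (by push_cast; ring)
  · intro z
    have h := ((hasDerivAt_id' z).fun_add (((hasDerivAt_id' z).pow 3).div_const 3)).const_mul (2 * μ)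
    exact h.congr_deriv (by push_cast; ring)
  · intro t
    exact ((hasDerivAt_id' t).const_mul (2 * μ)).congr_deriv (by ring)
  · intro t; simpa using hμ
  · intro z x₀ x₁; ring
  · intro z; norm_num

end Summit.NavierStokesRegularity.NavierStokesRegularity.Theorems.PoloidalWindowDoorPoloidalWindowRigidityZShockTurningShearQuadratic

end
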